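import Literature.MathematicalPhysics.QuantumFieldTheory.Balaban1983to89.Node00.WilsonActionSecondVariationNearFlat
import Literature.MathematicalPhysics.QuantumFieldTheory.Balaban1983to89.T4ReTrLipUnitary

/-!
# NODE 00 — THE SECOND VARIATION OF THE WILSON ACTION (5), IV: GAUGE COVARIANCE — [B16] p.358 «The above inequality holds for U₀ in an arbitrary gauge»:
# `A((U^u)·e^{t·Ad_u X}) = A(U·e^{tX})` for every gauge transformation `u`, hence `Q_{U^u}(Ad_u X) = Q_U(X)`; with the near-flat comparison of the prequel, the TWO-SIDED
# letter (b) for a background that is near `1` only AFTER a gauge transformation, against the pure gauge `1^{u⁻¹}` (flat plaquette variables)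

Cell `pub-ymgap`, WIDTH SEAT `pub-ymgap-dag-n12-w2` generation 0 (HUMAN RULING D-0149 ∕ director-ym №197; DAG node N12 = [B15]; successor piece after W-SEAT-START-LIST v2 §N12 ITEM 2 =
U2a; INBOX INTENT-6).  CONSUMED BY NAME: this seat's p583639 (`expChart`-ray letters), p587195 (`abs_deriv_deriv_wilsonAction4_expChart_sub_flat_le_local`), the tree's
`T4ReTrLipUnitary.plaqHol_gaugeAct` (gauge covariance of plaquette variables), `T4AdjointCovarianceUnitary.specialUnitaryAd` ∕ `expSU_specialUnitaryAd` (`Ad(g)` on `𝔰𝔲(N)` and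
«R(u)exp iηA = exp iηR(u)A»), n07-e's `Node00.expChart`.  `--kind proof --supports stmt-QuantumFields-20542` (K1⁷; count-neutral).

PRINT.  [B16] = [Balaban1989LargeFieldII] p. 357: «we apply the construction of Sect. F [15] to the configuration U₀, and doing a proper gauge transformation we represent it on the domain Z
as exp iξA₀ … We also have to do the compensating adjoint gauge transformation on the variables B′»; p. 358, after (1.9): «The above inequality holds for U₀ in an arbitrary gauge».
[B9] = [Balaban1985BackgroundPropagators] p. 395 (3.29): «Of course R(u(x))exp iηA(x,x′) = exp iηR(u(x))A(x,x′)».  [B7] = [Balaban1985Averaging] (8)–(9), (12) p. 19: `U^u`, gauge invariance.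

CONTENTS (theorems only; no `def`).  `u : GaugeTransf P j (SU N)`, `U^u_b = u(b₋)U_b u(b₊)⁻¹` (`GaugeField.gaugeAct`), the compensating adjoint transformation of directions
`(Ad_u X)_b = u(b₊)X_b u(b₊)⁻¹` (the right chart `U_b·e^{X_b}` sits at `b₊`).
* §1 `expChart_gaugeAct` — `(U^u)·e^{Ad_u X} = (U·e^{X})^u`; `wilsonAction4_expChart_gaugeAct` — `A((U^u)·e^{Ad_u X}) = A(U·e^{X})` (gauge invariance of (5)); the ray versions
  `wilsonAction4_expChart_smul_gaugeAct` (as functions of `t`) and ★ `deriv_deriv_wilsonAction4_expChart_gaugeAct` — `Q_{U^u}(Ad_u X) = Q_U(X)` (every derivative agrees).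
* §2 `gaugeAct_gaugeAct_inv_one` (`(1^{u⁻¹})^u = 1`), `norm_coe_specialUnitaryAd` (`‖Ad_g X‖ = ‖X‖`, operator norm) and ★★★ `abs_deriv_deriv_wilsonAction4_expChart_sub_pureGauge_le` — if the
  background is near `1` IN THE GAUGE `u` (`‖(U^u)_b − 1‖ ≤ δ_p` on the bonds of the plaquettes that see `X`), then `|Q_U(X) − Q_{1^{u⁻¹}}(X)| ≤ 4·Σ_p δ_p·(Σ_k‖X_{b_k}‖)²`, the comparison
  configuration `1^{u⁻¹}` being a PURE GAUGE (all plaquette variables `1`); ★ `deriv_deriv_wilsonAction4_expChart_pureGauge_eq_norm_sq` — its value EXPLICITLY: `Q_{1^{u⁻¹}}(X) = Q_1(Ad_u X) =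
  (1∕N)Σ_p‖d(Ad_u X)(p)‖²_{HS}` (the flat form of the Ad-transformed direction; dag-n12-w4 reads `‖·‖_{HS}` as its `oc`).

HONEST FRAMING: bookkeeping (gauge invariance of the tree's own functional + the prequel's estimate); no gauge FIXING is performed (the existence of a good gauge for `U₀` is
[15] Sect. F ∕ [B16] p.357, not here); count-neutral; N12 NOT discharged (5∕27 unmoved); finite 𝕋⁴ at fixed ε, Bałaban AS PRINTED with locators; R4 closes the conditional rung
`BalabanLadder.UV` only — NOT continuum ∕ ℝ⁴ ∕ OS ∕ mass gap ∕ Clay.  No `sorry`, no `def`, no `instance`.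
-/

noncomputable section

namespace Literature.MathematicalPhysics.QuantumFieldTheory.Balaban1983to89.Node00

open T4AdjointCovarianceUnitary (lieSU expSU specialUnitaryAd coe_specialUnitaryAd expSU_specialUnitaryAd)
open scoped Matrix.Norms.L2Operator

/-! ## §1  Gauge covariance of the exponential chart and gauge invariance of the action along it -/

section Covariance

variable {P : Params} {j : ℕ} {N : ℕ} [NeZero N]

/-- ★ **THE CHART IS GAUGE COVARIANT WITH THE COMPENSATING ADJOINT TRANSFORMATION**: `(U^u)_b · exp(u(b₊)X_b u(b₊)⁻¹) = (U·e^{X})^u_b` («R(u)exp iηA = exp iηR(u)A», (3.29); «the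
compensating adjoint gauge transformation on the variables B′», [B16] p.357). [cite: Balaban1985BackgroundPropagators, (3.29) p.395; Balaban1989LargeFieldII, p.357; Balaban1985Averaging, (8) p.19] -/
theorem expChart_gaugeAct (u : GaugeTransf P j (SU N)) (U : GaugeField P j (SU N)) (X : PBond P j → lieSU (Fin N)) :
    expChart (GaugeField.gaugeAct u U) (fun b => specialUnitaryAd (u b.tgt) (X b)) = GaugeField.gaugeAct u (expChart U X) := by
  funext b
  show u b.src * U b * (u b.tgt)⁻¹ * expSU (specialUnitaryAd (u b.tgt) (X b)) = u b.src * (U b * expSU (X b)) * (u b.tgt)⁻¹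
  rw [expSU_specialUnitaryAd]
  group

omit [NeZero N] in
/-- Scaling commutes with the compensating transformation: `Ad_u(tX) = t·Ad_u X` (linearity of `Ad`). [cite: Balaban1985BackgroundPropagators, (3.29) p.395] -/
theorem specialUnitaryAd_smul_apply (u : GaugeTransf P j (SU N)) (X : PBond P j → lieSU (Fin N)) (t : ℝ) :
    (fun b => specialUnitaryAd (u b.tgt) ((t • X) b)) = t • fun b => specialUnitaryAd (u b.tgt) (X b) := by
  funext b
  simp only [Pi.smul_apply, map_smul]

/-- **GAUGE INVARIANCE OF (5) ALONG THE CHART**: `A((U^u)·e^{Ad_u X}) = A(U·e^{X})` (`U^u(∂p) = u(x)U(∂p)u(x)⁻¹`, `Re tr` is conjugation invariant).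
[cite: Balaban1985Averaging, (12) p.19; Balaban1989LargeFieldII, p.358 («holds for U₀ in an arbitrary gauge»)] -/
theorem wilsonAction4_expChart_gaugeAct (u : GaugeTransf P j (SU N)) (U : GaugeField P j (SU N)) (X : PBond P j → lieSU (Fin N)) :
    wilsonAction4 (expChart (GaugeField.gaugeAct u U) (fun b => specialUnitaryAd (u b.tgt) (X b))) = wilsonAction4 (expChart U X) := by
  rw [expChart_gaugeAct]
  unfold wilsonAction4 wilsonAction
  simp only [T4ReTrLipUnitary.plaqHol_gaugeAct, GaugeGroup.reTr_conj]

/-- The ray version, as an identity of functions of `t`: `A((U^u)·e^{t·Ad_u X}) = A(U·e^{tX})`. [cite: Balaban1989LargeFieldII, p.358] -/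
theorem wilsonAction4_expChart_smul_gaugeAct (u : GaugeTransf P j (SU N)) (U : GaugeField P j (SU N)) (X : PBond P j → lieSU (Fin N)) :
    (fun t : ℝ => wilsonAction4 (expChart (GaugeField.gaugeAct u U) (t • fun b => specialUnitaryAd (u b.tgt) (X b))))
      = fun t : ℝ => wilsonAction4 (expChart U (t • X)) := by
  funext t
  rw [← specialUnitaryAd_smul_apply, wilsonAction4_expChart_gaugeAct]

/-- ★ **THE SECOND VARIATION IS GAUGE COVARIANT**: `Q_{U^u}(Ad_u X) = Q_U(X)` — `d²∕dt² A((U^u)·e^{t·Ad_u X})∣₀ = d²∕dt² A(U·e^{tX})∣₀` (and likewise every derivative, the two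
functions of `t` being equal). [cite: Balaban1989LargeFieldII, p.358 («The above inequality holds for U₀ in an arbitrary gauge»)] -/
theorem deriv_deriv_wilsonAction4_expChart_gaugeAct (u : GaugeTransf P j (SU N)) (U : GaugeField P j (SU N)) (X : PBond P j → lieSU (Fin N)) :
    deriv (deriv fun t : ℝ => wilsonAction4 (expChart (GaugeField.gaugeAct u U) (t • fun b => specialUnitaryAd (u b.tgt) (X b)))) 0
      = deriv (deriv fun t : ℝ => wilsonAction4 (expChart U (t • X))) 0 := by
  rw [wilsonAction4_expChart_smul_gaugeAct]

end Covariance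

/-! ## §2  Letter (b) for a background near `1` in SOME gauge, against the pure gauge -/

section ArbitraryGauge

variable {P : Params} {j : ℕ} {N : ℕ} [NeZero N]

/-- `(1^{u⁻¹})^u = 1`: transforming the pure gauge `b ↦ u(b₋)⁻¹u(b₊)` back by `u` gives the trivial configuration. [cite: Balaban1985Averaging, (8) p.19 (bookkeeping)] -/
theorem gaugeAct_gaugeAct_inv_one (u : GaugeTransf P j (SU N)) :
    GaugeField.gaugeAct u (GaugeField.gaugeAct (fun x => (u x)⁻¹) (1 : GaugeField P j (SU N))) = 1 := by
  funext b
  show u b.src * ((u b.src)⁻¹ * 1 * ((u b.tgt)⁻¹)⁻¹) * (u b.tgt)⁻¹ = 1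
  group

omit [NeZero N] in
/-- The compensating transformation is an isometry of the letters in the operator norm (19): `‖u X u⋆‖ = ‖X‖`. [cite: Balaban1985Averaging, (19)–(20) p.21] -/
theorem norm_coe_specialUnitaryAd (g : SU N) (X : lieSU (Fin N)) :
    ‖((specialUnitaryAd g X : lieSU (Fin N)) : Matrix (Fin N) (Fin N) ℂ)‖ = ‖(X : Matrix (Fin N) (Fin N) ℂ)‖ := by
  rw [coe_specialUnitaryAd, CStarRing.norm_mul_mem_unitary _ (Unitary.star_mem g.2.1), CStarRing.norm_mem_unitary_mul _ g.2.1]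

/-- ★★★ **LETTER (b) IN AN ARBITRARY GAUGE**: if the background `U` is near `1` AFTER the gauge transformation `u` — `‖(U^u)_b − 1‖ ≤ δ_p` for the four bonds of each plaquette
`p` (any budget `δ_p`, e.g. `2`, where `X` vanishes on `∂p`) — then its second variation is within `4·Σ_p δ_p(Σ_k‖X_{b_k}‖)²` of that of the PURE GAUGE `1^{u⁻¹} = (b ↦ u(b₋)⁻¹u(b₊))`
(whose plaquette variables are all `1`, so p585069's flat form `secondVariation_expChart_of_plaqHol_eq_one` evaluates it): `|Q_U(X) − Q_{1^{u⁻¹}}(X)| ≤ 4·Σ_p δ_p·(Σ_k‖X_{b_k}‖)²`.  [B16] p.357–358: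
«doing a proper gauge transformation we represent it … as exp iξA₀ … The above inequality holds for U₀ in an arbitrary gauge». [cite: Balaban1989LargeFieldII, p.357, (1.9) p.358; Balaban1985BackgroundPropagators, (3.10) p.392] -/
theorem abs_deriv_deriv_wilsonAction4_expChart_sub_pureGauge_le (u : GaugeTransf P j (SU N)) (U : GaugeField P j (SU N)) (X : PBond P j → lieSU (Fin N))
    (δ : Plaq P j → ℝ)
    (hδ : ∀ p : Plaq P j, ‖((GaugeField.gaugeAct u U ⟨p.src, p.μ⟩ : SU N) : Matrix (Fin N) (Fin N) ℂ) - 1‖ ≤ δ p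
      ∧ ‖((GaugeField.gaugeAct u U ⟨p.src.shift p.μ, p.ν⟩ : SU N) : Matrix (Fin N) (Fin N) ℂ) - 1‖ ≤ δ p
      ∧ ‖((GaugeField.gaugeAct u U ⟨p.src.shift p.ν, p.μ⟩ : SU N) : Matrix (Fin N) (Fin N) ℂ) - 1‖ ≤ δ p
      ∧ ‖((GaugeField.gaugeAct u U ⟨p.src, p.ν⟩ : SU N) : Matrix (Fin N) (Fin N) ℂ) - 1‖ ≤ δ p) :
    |deriv (deriv fun t : ℝ => wilsonAction4 (expChart U (t • X))) 0
        - deriv (deriv fun t : ℝ => wilsonAction4 (expChart (GaugeField.gaugeAct (fun x => (u x)⁻¹) (1 : GaugeField P j (SU N))) (t • X))) 0|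
      ≤ 4 * ∑ p : Plaq P j, δ p * (‖(X ⟨p.src, p.μ⟩ : Matrix (Fin N) (Fin N) ℂ)‖ + ‖(X ⟨p.src.shift p.μ, p.ν⟩ : Matrix (Fin N) (Fin N) ℂ)‖
        + ‖(X ⟨p.src.shift p.ν, p.μ⟩ : Matrix (Fin N) (Fin N) ℂ)‖ + ‖(X ⟨p.src, p.ν⟩ : Matrix (Fin N) (Fin N) ℂ)‖) ^ 2 := by
  -- move both second variations into the gauge `u`
  rw [← deriv_deriv_wilsonAction4_expChart_gaugeAct u U X,
    ← deriv_deriv_wilsonAction4_expChart_gaugeAct u (GaugeField.gaugeAct (fun x => (u x)⁻¹) 1) X, gaugeAct_gaugeAct_inv_one]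
  have h := abs_deriv_deriv_wilsonAction4_expChart_sub_flat_le_local (GaugeField.gaugeAct u U) (fun b => specialUnitaryAd (u b.tgt) (X b)) δ hδ
  simp only [norm_coe_specialUnitaryAd] at h
  exact h

/-- ★ **THE COMPARISON VALUE, EXPLICITLY** (dag-n12-w4's (β)): the second variation at the pure gauge `1^{u⁻¹}` is the FLAT form of the Ad-transformed direction —
`d²∕dt² A(1^{u⁻¹}·e^{tX})∣₀ = (1∕N)·Σ_p ‖(Ad_u X)⟨x,μ⟩ + (Ad_u X)⟨x+e_μ,ν⟩ − (Ad_u X)⟨x+e_ν,μ⟩ − (Ad_u X)⟨x,ν⟩‖²` (Hilbert–Schmidt norm (17) of `𝔰𝔲(N)`; `(Ad_u X)_b = u(b₊)X_b u(b₊)⁻¹`), by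
`Q_{1^{u⁻¹}}(X) = Q_1(Ad_u X)` (§1) and p587195's `deriv_deriv_wilsonAction4_expChart_one_eq_norm_sq`. [cite: Balaban1989LargeFieldII, p.357 («the compensating adjoint gauge transformation on the variables B′»), p.358] -/
theorem deriv_deriv_wilsonAction4_expChart_pureGauge_eq_norm_sq (u : GaugeTransf P j (SU N)) (X : PBond P j → lieSU (Fin N)) :
    deriv (deriv fun t : ℝ => wilsonAction4 (expChart (GaugeField.gaugeAct (fun x => (u x)⁻¹) (1 : GaugeField P j (SU N))) (t • X))) 0
      = (∑ p : Plaq P j, ‖specialUnitaryAd (u (⟨p.src, p.μ⟩ : PBond P j).tgt) (X ⟨p.src, p.μ⟩)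
          + specialUnitaryAd (u (⟨p.src.shift p.μ, p.ν⟩ : PBond P j).tgt) (X ⟨p.src.shift p.μ, p.ν⟩)
          - specialUnitaryAd (u (⟨p.src.shift p.ν, p.μ⟩ : PBond P j).tgt) (X ⟨p.src.shift p.ν, p.μ⟩)
          - specialUnitaryAd (u (⟨p.src, p.ν⟩ : PBond P j).tgt) (X ⟨p.src, p.ν⟩)‖ ^ 2) / (Fintype.card (Fin N) : ℝ) := by
  rw [← deriv_deriv_wilsonAction4_expChart_gaugeAct u (GaugeField.gaugeAct (fun x => (u x)⁻¹) 1) X, gaugeAct_gaugeAct_inv_one,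
    deriv_deriv_wilsonAction4_expChart_one_eq_norm_sq]

end ArbitraryGauge

end Literature.MathematicalPhysics.QuantumFieldTheory.Balaban1983to89.Node00

end
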